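import Summits.BirchSwinnertonDyer.BirchSwinnertonDyer.Theorems.KatoDescentPotSupersingularWildUpperUnitTwistRecordsClassO614
import Summits.BirchSwinnertonDyer.BirchSwinnertonDyer.Theorems.KatoDescentPotSupersingularWildUpperUnitTwistRecordsClassO615
import Summits.BirchSwinnertonDyer.BirchSwinnertonDyer.Theorems.KatoDescentPotSupersingularWildUpperUnitTwistRecordsClassO617
import Summits.BirchSwinnertonDyer.BirchSwinnertonDyer.Theorems.KatoDescentPotSupersingularWildUpperUnitTwistRecordsFlat35
import Summits.BirchSwinnertonDyer.BirchSwinnertonDyer.Theorems.KatoDescentPotSupersingularWildUpperUnitTwistRecordsFlat37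
import Summits.BirchSwinnertonDyer.BirchSwinnertonDyer.Theorems.KatoDescentPotSupersingularWildUpperUnitTwistRecordsFlat38
import Summits.BirchSwinnertonDyer.BirchSwinnertonDyer.Theorems.KatoDescentPotSupersingularWildUpperUnitTwistRecordsFlat63
import Summits.BirchSwinnertonDyer.BirchSwinnertonDyer.Theorems.KatoDescentPotSupersingularWildUpperUnitTwistRecordsFlat65
import Summits.BirchSwinnertonDyer.BirchSwinnertonDyer.Theorems.KatoDescentPotSupersingularWildFineSelmerSupersingularCMAnchor
import Summits.BirchSwinnertonDyer.BirchSwinnertonDyer.Theorems.KatoDescentPotSupersingularWildUpperDivisionFieldFukudaDoor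
import Literature.NumberTheory.EllipticCurves.FineSelmerIsotypicClassGroupCriterion
import HarnessLib

/-!
# Route `KatoDescentPotSupersingular` (rung K9, sub-rung B5 = O6 wild `p = 3`, cell `bsd-potss`): per-row records on the FACT-FREE door L6
# (HOM-TRIVIAL form: `3 ∣ h(ℚ(E[3]))` but no `E[3]` in `Cl(ℚ(E[3])) ⊗ 𝔽₃`) — statement (A) of Coates–Sujatha at `(E, 3)` with NO named fact, and U₀ modulo `hKatoA hGZK hmod`, for K9 U₀-ns rows that had
# NO fact-free (A) record so far, part 13 (hom-trivial part 3 of 5): 338688br1, 338688bt1, 338688cg1, 382347cq1, 382347cv1, 382347g1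
# (seat `bsd-potss-k9-c4` g24; same road as this seat's door file `…WildFineSelmerClassNumberL6Door` (p697251), inlined: one call of conjA-anchor
# g16/g17's kernel door L6 `CoatesSujatha2005.conjA_of_not_dvd_card_classGroup` per row; `--supports stmt-BirchSwinnertonDyer-19197 --as helper`)

HONEST FRAMING. THEOREMS ONLY (no definition, no named fact, no `sorry`); PER ROW — NOT a class theorem; nothing is booked; items 19189 / 19197 /
19942 / 19386 stay OPEN at class level (class-wide open input of record: the zeta crux 24327); Conjecture A and BSD are proved for NO class of
curves.  ROAD (door L6 of conjA-anchor g15 §9, KERNEL since g16/g17 2026-08-29; entry point `CoatesSujatha2005.conjA_of_homTrivial_divisionField`):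
`E[3]` irreducible (kernel `irr_g…_3`), `Δ(E)` a CUBE (kernel `Δ_cube_g…` ⟹ `ρ̄₃` not onto ⟹ `3 ∤ #Gal(ℚ(E[3])/ℚ)`), (c2*)₀ «every additive
`Γ_ℚ`-equivariant map `Cl(𝓞_ℚ(E[3])) → E[3]` is zero» (DISPLAYED `h0`; numerically: the `E[3]`-isotypic multiplicity of `Cl(ℚ(E[3])) ⊗ 𝔽₃` is
`m_ρ̄ = 0` although `3 ∣ h` — conjA-anchor g15 kit j313355 `drsl1` at layer 0 on the degree-16 field, isotypic projector from Frobenius traces, with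
the `E[3]`-vs-dual convention certified by explicit 3-torsion points kit j313432; class group CERTIFIED by `bnfcertify` kit j316482 where marked CERT,
else GRH), and `E(ℚ₃)[3] = 0` (DISPLAYED `hD`: no non-zero point of `E[3]` fixed by the decomposition group at `3`; `t3 = 1` of k9-c4 g7 kit j265757)
⟹ (A) at `(E,3)` for every cyclotomic `ℤ₃`-extension — NO NAMED FACT (`conjA_g…_3_L6h`); and U₀ modulo `hKatoA hGZK hmod` + Cremona's `r_an = 0`
(`missingUpperBoundAt_g…_3_L6h`).  NOTHING is assumed at the bad places.  SCOPE: the 29 K9 rows (all `3Nn`, `t3 = 1`) of conjA-anchor g15's L6 census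
with `3 ∣ h(ℚ(E[3]))` and `m_ρ̄ = 0`; none of them had a fact-free (A) record (disjoint from k8t-c4 g21's 167 NoCS rows and from parts 01–10's 61).
KERNEL lemmas `isElliptic_g…`, `isGloballyMinimal_g…`, `irr_g…_3`, `classO6_g…_3` are IMPORTED (k9-c4 g16–g18 / k8t-c4 g15 files, namespace
`…Theorems.WildUpperUnitTwistRecords`).

References: [CoatesSujatha2005] Thm. 3.4, Lemma 3.8; [DeoRaySujatha2023] Thm. 3.8/3.9 (b) (arXiv:2202.09937 pp. 9–10); [Washington1997] §13.3,
Thm. 10.4; [Serre1972] §2.4 Prop. 15, §5.3; [Kato2004Asterisque] Thm. 14.5 (3), Prop. 14.16 (2); [Cremona2006] Table 1.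
-/

set_option autoImplicit false
set_option linter.dupNamespace false

noncomputable section

open scoped Classical NumberField
open WeierstrassCurve NumberField Field IsDedekindDomain IntermediateField
  Literature.NumberTheory.EllipticCurves Literature.NumberTheory.EllipticCurves.Rank1Residual
  Literature.NumberTheory.EllipticCurves.Rank1Residual.Typed
  Literature.NumberTheory.GaloisRepresentations Literature.NumberTheory.SerreUniformity Literature.NumberTheory.IwasawaTheory
  Summit.BirchSwinnertonDyer.Rank1Residual Summit.BirchSwinnertonDyer.Rank1Residual.Additive
  Summit.BirchSwinnertonDyer.BirchSwinnertonDyer.Theorems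
  Summit.BirchSwinnertonDyer.BirchSwinnertonDyer.Theorems.WildUpperUnitTwistRecords

namespace Summit.BirchSwinnertonDyer.BirchSwinnertonDyer.Theorems.WildFineSelmerClassNumberL6Records

/-! ### `338688br1` @ `p = 3` — `N = 338688`; Cremona: `r_an = 0`; O6 wild at `3`; image `3Nn` (census); `ℚ(E[3])` of degree `16`: `h = 144` (CERT; `3 ∣ h`, `E[3]` ABSENT from `Cl ⊗ 𝔽₃`);
`m_ρ̄(Cl/3) = 0` (kit j313355/j313432); `#E(ℚ₃)[3] = 1` (kit j265757); bad places `2:1;7:1`. First fact-free (A) record for this row. -/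

/-- `Δ(338688br1) = ((-32928))³` — a CUBE (kernel, `norm_num`). [cite: Serre1972, §5.3] [cite: Cremona2006, Table 1 (Cremona label 338688br1)] -/
theorem Δ_cube_g338688br1 : (⟨0, 0, 0, (-41160), 3226944⟩ : WeierstrassCurve ℚ).Δ = (((-32928) : ℚ)) ^ 3 := by
  norm_num [WeierstrassCurve.Δ, WeierstrassCurve.b₂, WeierstrassCurve.b₄, WeierstrassCurve.b₆, WeierstrassCurve.b₈]

/-- **(A) AT `(338688br1, 3)` — NO NAMED FACT (hom-trivial door L6).**  Statement (A) of Coates–Sujatha for THIS curve at `p = 3` (the dual fine Selmer group over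
`ℚ_cyc` is finitely generated over `ℤ₃`, every cyclotomic `ℤ₃`-extension), by door L6 (hom-trivial form): KERNEL `irr_g338688br1_3`, `Δ_cube_g338688br1`;
DISPLAYED `h0` ((c2*)₀: no `E[3]` in `Cl(ℚ(E[3])) ⊗ 𝔽₃` — `h = 144`, `m_ρ̄ = 0`, CERT, kit j313355/j313432) and `hD` (`E(ℚ₃)[3] = 0`; `t3 = 1`, kit j265757).
Per row; nothing booked. [cite: CoatesSujatha2005, §3 Thm. 3.4, Lemma 3.8 and Cor. 3.6] [cite: DeoRaySujatha2023, §3 Thm. 3.8 (c2) (arXiv:2202.09937 p. 9)]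
[cite: Serre1972, §2.4 Prop. 15, §5.3] [cite: Cremona2006, Table 1 (Cremona label 338688br1)] -/
theorem conjA_g338688br1_3_L6h
    {W : WeierstrassCurve ℚ} [W.IsElliptic] (hWeq : W = (⟨0, 0, 0, (-41160), 3226944⟩ : WeierstrassCurve ℚ))
    (h0 : haveI : NumberField ↥(W.divisionField 3) := NumberField.mk
      ∀ μ : Additive (ClassGroup (𝓞 ↥(W.divisionField 3))) →+ geomTorsion W ((3 : ℕ) : ℤ),
        (∀ (τ : absoluteGaloisGroup ℚ) (c : ClassGroup (𝓞 ↥(W.divisionField 3))),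
          μ (Additive.ofMul (ClassGroup.mulEquiv
            (Literature.NumberTheory.NumberFields.AmbiguousClass.intAut (absRestrictNormalHom (W.divisionField 3) τ)) c)) =
            τ • μ (Additive.ofMul c)) → μ = 0)
    (hD : ∀ v : HeightOneSpectrum (𝓞 ℚ), ((3 : ℕ) : 𝓞 ℚ) ∈ v.asIdeal →
      ∀ x : geomTorsion W ((3 : ℕ) : ℤ), (∀ δ ∈ GreenbergSelmer.decomp v, δ • x = x) → x = 0)
    (κ : ZpExtension ℚ 3) (hκ : κ.IsCyclotomic) :
    ∃ (γ : absoluteGaloisGroup ℚ) (Df : W.FineSelmerDualData κ γ),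
      Module.Finite ℤ_[3] (RestrictScalars ℤ_[3] (IwasawaAlgebra 3) Df.X) := by
  subst hWeq
  haveI : Fact (Nat.Prime 3) := ⟨Nat.prime_three⟩
  haveI : NumberField ↥((⟨0, 0, 0, (-41160), 3226944⟩ : WeierstrassCurve ℚ).divisionField 3) := NumberField.mk
  exact CoatesSujatha2005.conjA_of_homTrivial_divisionField _ (by decide)
    (DivisionFieldFukudaDoor.not_dvd_card_aut_divisionField_three_of_Δ_eq_cube _ irr_g338688br1_3 Δ_cube_g338688br1) hκ h0 hD

/-- **RECORD — U₀ `ord₃ #Ш(E) ≤ ord₃ #Ш(E)_an` for `E = 338688br1` at `p = 3` on the fact-free door L6, hom-trivial form** (U₀-ns row of K9 items 19189 / 19197):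
KERNEL `classO6_g338688br1_3`, `irr_g338688br1_3`, `Δ_cube_g338688br1`; DISPLAYED named facts `hKatoA hGZK hmod` ONLY, Cremona's `r_an = 0` (`hr`), and the two
numerics `h0` (`m_ρ̄(Cl(ℚ(E[3]))/3) = 0`, `h = 144`, CERT) / `hD` (`#E(ℚ₃)[3] = 1`). Per row; nothing booked; BSD is not proved by this.
[cite: Kato2004Asterisque, Thm. 14.5 (3) (p. 236) and Prop. 14.16 (2)] [cite: CoatesSujatha2005, §3 Thm. 3.4]
[cite: DeoRaySujatha2023, §3 Thm. 3.8 (c2)] [cite: Cremona2006, Table 1 (Cremona label 338688br1)] -/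
theorem missingUpperBoundAt_g338688br1_3_L6h
    (hKatoA : Kato2004.rankZero_padicValNat_sha_add_padicValNat_tamagawa_le_of_additive_potGood_of_irreducible_of_fineSelmerDual_fg)
    (hGZK : rank_eq_analyticRank_of_analyticRank_le_one) (hmod : hasEntireLFunction_rat)
    {W : WeierstrassCurve ℚ} [W.IsElliptic] [W.IsGloballyMinimal] (hWeq : W = (⟨0, 0, 0, (-41160), 3226944⟩ : WeierstrassCurve ℚ)) (hr : W.analyticRank = 0)
    (h0 : haveI : NumberField ↥(W.divisionField 3) := NumberField.mk
      ∀ μ : Additive (ClassGroup (𝓞 ↥(W.divisionField 3))) →+ geomTorsion W ((3 : ℕ) : ℤ),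
        (∀ (τ : absoluteGaloisGroup ℚ) (c : ClassGroup (𝓞 ↥(W.divisionField 3))),
          μ (Additive.ofMul (ClassGroup.mulEquiv
            (Literature.NumberTheory.NumberFields.AmbiguousClass.intAut (absRestrictNormalHom (W.divisionField 3) τ)) c)) =
            τ • μ (Additive.ofMul c)) → μ = 0)
    (hD : ∀ v : HeightOneSpectrum (𝓞 ℚ), ((3 : ℕ) : 𝓞 ℚ) ∈ v.asIdeal →
      ∀ x : geomTorsion W ((3 : ℕ) : ℤ), (∀ δ ∈ GreenbergSelmer.decomp v, δ • x = x) → x = 0) :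
    MissingUpperBoundAt W 3 := by
  subst hWeq
  haveI : Fact (Nat.Prime 3) := ⟨Nat.prime_three⟩
  exact WildFineSelmerSupersingularCMAnchor.missingUpperBoundAt_wild_of_conjA hKatoA hGZK hmod _ hr classO6_g338688br1_3 irr_g338688br1_3
    (fun κ hκ => conjA_g338688br1_3_L6h rfl h0 hD κ hκ)

/-! ### `338688bt1` @ `p = 3` — `N = 338688`; Cremona: `r_an = 0`; O6 wild at `3`; image `3Nn` (census); `ℚ(E[3])` of degree `16`: `h = 1296` (CERT; `3 ∣ h`, `E[3]` ABSENT from `Cl ⊗ 𝔽₃`);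
`m_ρ̄(Cl/3) = 0` (kit j313355/j313432); `#E(ℚ₃)[3] = 1` (kit j265757); bad places `2:1;7:1`. First fact-free (A) record for this row. -/

/-- `Δ(338688bt1) = ((-74088))³` — a CUBE (kernel, `norm_num`). [cite: Serre1972, §5.3] [cite: Cremona2006, Table 1 (Cremona label 338688bt1)] -/
theorem Δ_cube_g338688bt1 : (⟨0, 0, 0, (-92610), 10890936⟩ : WeierstrassCurve ℚ).Δ = (((-74088) : ℚ)) ^ 3 := by
  norm_num [WeierstrassCurve.Δ, WeierstrassCurve.b₂, WeierstrassCurve.b₄, WeierstrassCurve.b₆, WeierstrassCurve.b₈]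

/-- **(A) AT `(338688bt1, 3)` — NO NAMED FACT (hom-trivial door L6).**  Statement (A) of Coates–Sujatha for THIS curve at `p = 3` (the dual fine Selmer group over
`ℚ_cyc` is finitely generated over `ℤ₃`, every cyclotomic `ℤ₃`-extension), by door L6 (hom-trivial form): KERNEL `irr_g338688bt1_3`, `Δ_cube_g338688bt1`;
DISPLAYED `h0` ((c2*)₀: no `E[3]` in `Cl(ℚ(E[3])) ⊗ 𝔽₃` — `h = 1296`, `m_ρ̄ = 0`, CERT, kit j313355/j313432) and `hD` (`E(ℚ₃)[3] = 0`; `t3 = 1`, kit j265757).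
Per row; nothing booked. [cite: CoatesSujatha2005, §3 Thm. 3.4, Lemma 3.8 and Cor. 3.6] [cite: DeoRaySujatha2023, §3 Thm. 3.8 (c2) (arXiv:2202.09937 p. 9)]
[cite: Serre1972, §2.4 Prop. 15, §5.3] [cite: Cremona2006, Table 1 (Cremona label 338688bt1)] -/
theorem conjA_g338688bt1_3_L6h
    {W : WeierstrassCurve ℚ} [W.IsElliptic] (hWeq : W = (⟨0, 0, 0, (-92610), 10890936⟩ : WeierstrassCurve ℚ))
    (h0 : haveI : NumberField ↥(W.divisionField 3) := NumberField.mk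
      ∀ μ : Additive (ClassGroup (𝓞 ↥(W.divisionField 3))) →+ geomTorsion W ((3 : ℕ) : ℤ),
        (∀ (τ : absoluteGaloisGroup ℚ) (c : ClassGroup (𝓞 ↥(W.divisionField 3))),
          μ (Additive.ofMul (ClassGroup.mulEquiv
            (Literature.NumberTheory.NumberFields.AmbiguousClass.intAut (absRestrictNormalHom (W.divisionField 3) τ)) c)) =
            τ • μ (Additive.ofMul c)) → μ = 0)
    (hD : ∀ v : HeightOneSpectrum (𝓞 ℚ), ((3 : ℕ) : 𝓞 ℚ) ∈ v.asIdeal →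
      ∀ x : geomTorsion W ((3 : ℕ) : ℤ), (∀ δ ∈ GreenbergSelmer.decomp v, δ • x = x) → x = 0)
    (κ : ZpExtension ℚ 3) (hκ : κ.IsCyclotomic) :
    ∃ (γ : absoluteGaloisGroup ℚ) (Df : W.FineSelmerDualData κ γ),
      Module.Finite ℤ_[3] (RestrictScalars ℤ_[3] (IwasawaAlgebra 3) Df.X) := by
  subst hWeq
  haveI : Fact (Nat.Prime 3) := ⟨Nat.prime_three⟩
  haveI : NumberField ↥((⟨0, 0, 0, (-92610), 10890936⟩ : WeierstrassCurve ℚ).divisionField 3) := NumberField.mk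
  exact CoatesSujatha2005.conjA_of_homTrivial_divisionField _ (by decide)
    (DivisionFieldFukudaDoor.not_dvd_card_aut_divisionField_three_of_Δ_eq_cube _ irr_g338688bt1_3 Δ_cube_g338688bt1) hκ h0 hD

/-- **RECORD — U₀ `ord₃ #Ш(E) ≤ ord₃ #Ш(E)_an` for `E = 338688bt1` at `p = 3` on the fact-free door L6, hom-trivial form** (U₀-ns row of K9 items 19189 / 19197):
KERNEL `classO6_g338688bt1_3`, `irr_g338688bt1_3`, `Δ_cube_g338688bt1`; DISPLAYED named facts `hKatoA hGZK hmod` ONLY, Cremona's `r_an = 0` (`hr`), and the two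
numerics `h0` (`m_ρ̄(Cl(ℚ(E[3]))/3) = 0`, `h = 1296`, CERT) / `hD` (`#E(ℚ₃)[3] = 1`). Per row; nothing booked; BSD is not proved by this.
[cite: Kato2004Asterisque, Thm. 14.5 (3) (p. 236) and Prop. 14.16 (2)] [cite: CoatesSujatha2005, §3 Thm. 3.4]
[cite: DeoRaySujatha2023, §3 Thm. 3.8 (c2)] [cite: Cremona2006, Table 1 (Cremona label 338688bt1)] -/
theorem missingUpperBoundAt_g338688bt1_3_L6h
    (hKatoA : Kato2004.rankZero_padicValNat_sha_add_padicValNat_tamagawa_le_of_additive_potGood_of_irreducible_of_fineSelmerDual_fg)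
    (hGZK : rank_eq_analyticRank_of_analyticRank_le_one) (hmod : hasEntireLFunction_rat)
    {W : WeierstrassCurve ℚ} [W.IsElliptic] [W.IsGloballyMinimal] (hWeq : W = (⟨0, 0, 0, (-92610), 10890936⟩ : WeierstrassCurve ℚ)) (hr : W.analyticRank = 0)
    (h0 : haveI : NumberField ↥(W.divisionField 3) := NumberField.mk
      ∀ μ : Additive (ClassGroup (𝓞 ↥(W.divisionField 3))) →+ geomTorsion W ((3 : ℕ) : ℤ),
        (∀ (τ : absoluteGaloisGroup ℚ) (c : ClassGroup (𝓞 ↥(W.divisionField 3))),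
          μ (Additive.ofMul (ClassGroup.mulEquiv
            (Literature.NumberTheory.NumberFields.AmbiguousClass.intAut (absRestrictNormalHom (W.divisionField 3) τ)) c)) =
            τ • μ (Additive.ofMul c)) → μ = 0)
    (hD : ∀ v : HeightOneSpectrum (𝓞 ℚ), ((3 : ℕ) : 𝓞 ℚ) ∈ v.asIdeal →
      ∀ x : geomTorsion W ((3 : ℕ) : ℤ), (∀ δ ∈ GreenbergSelmer.decomp v, δ • x = x) → x = 0) :
    MissingUpperBoundAt W 3 := by
  subst hWeq
  haveI : Fact (Nat.Prime 3) := ⟨Nat.prime_three⟩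
  exact WildFineSelmerSupersingularCMAnchor.missingUpperBoundAt_wild_of_conjA hKatoA hGZK hmod _ hr classO6_g338688bt1_3 irr_g338688bt1_3
    (fun κ hκ => conjA_g338688bt1_3_L6h rfl h0 hD κ hκ)

/-! ### `338688cg1` @ `p = 3` — `N = 338688`; Cremona: `r_an = 0`; O6 wild at `3`; image `3Nn` (census); `ℚ(E[3])` of degree `16`: `h = 324` (GRH; `3 ∣ h`, `E[3]` ABSENT from `Cl ⊗ 𝔽₃`);
`m_ρ̄(Cl/3) = 0` (kit j313355/j313432); `#E(ℚ₃)[3] = 1` (kit j265757); bad places `2:1;7:1`. First fact-free (A) record for this row. -/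

/-- `Δ(338688cg1) = ((-1176))³` — a CUBE (kernel, `norm_num`). [cite: Serre1972, §5.3] [cite: Cremona2006, Table 1 (Cremona label 338688cg1)] -/
theorem Δ_cube_g338688cg1 : (⟨0, 0, 0, (-6762), 214032⟩ : WeierstrassCurve ℚ).Δ = (((-1176) : ℚ)) ^ 3 := by
  norm_num [WeierstrassCurve.Δ, WeierstrassCurve.b₂, WeierstrassCurve.b₄, WeierstrassCurve.b₆, WeierstrassCurve.b₈]

/-- **(A) AT `(338688cg1, 3)` — NO NAMED FACT (hom-trivial door L6).**  Statement (A) of Coates–Sujatha for THIS curve at `p = 3` (the dual fine Selmer group over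
`ℚ_cyc` is finitely generated over `ℤ₃`, every cyclotomic `ℤ₃`-extension), by door L6 (hom-trivial form): KERNEL `irr_g338688cg1_3`, `Δ_cube_g338688cg1`;
DISPLAYED `h0` ((c2*)₀: no `E[3]` in `Cl(ℚ(E[3])) ⊗ 𝔽₃` — `h = 324`, `m_ρ̄ = 0`, GRH, kit j313355/j313432) and `hD` (`E(ℚ₃)[3] = 0`; `t3 = 1`, kit j265757).
Per row; nothing booked. [cite: CoatesSujatha2005, §3 Thm. 3.4, Lemma 3.8 and Cor. 3.6] [cite: DeoRaySujatha2023, §3 Thm. 3.8 (c2) (arXiv:2202.09937 p. 9)]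
[cite: Serre1972, §2.4 Prop. 15, §5.3] [cite: Cremona2006, Table 1 (Cremona label 338688cg1)] -/
theorem conjA_g338688cg1_3_L6h
    {W : WeierstrassCurve ℚ} [W.IsElliptic] (hWeq : W = (⟨0, 0, 0, (-6762), 214032⟩ : WeierstrassCurve ℚ))
    (h0 : haveI : NumberField ↥(W.divisionField 3) := NumberField.mk
      ∀ μ : Additive (ClassGroup (𝓞 ↥(W.divisionField 3))) →+ geomTorsion W ((3 : ℕ) : ℤ),
        (∀ (τ : absoluteGaloisGroup ℚ) (c : ClassGroup (𝓞 ↥(W.divisionField 3))),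
          μ (Additive.ofMul (ClassGroup.mulEquiv
            (Literature.NumberTheory.NumberFields.AmbiguousClass.intAut (absRestrictNormalHom (W.divisionField 3) τ)) c)) =
            τ • μ (Additive.ofMul c)) → μ = 0)
    (hD : ∀ v : HeightOneSpectrum (𝓞 ℚ), ((3 : ℕ) : 𝓞 ℚ) ∈ v.asIdeal →
      ∀ x : geomTorsion W ((3 : ℕ) : ℤ), (∀ δ ∈ GreenbergSelmer.decomp v, δ • x = x) → x = 0)
    (κ : ZpExtension ℚ 3) (hκ : κ.IsCyclotomic) :
    ∃ (γ : absoluteGaloisGroup ℚ) (Df : W.FineSelmerDualData κ γ),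
      Module.Finite ℤ_[3] (RestrictScalars ℤ_[3] (IwasawaAlgebra 3) Df.X) := by
  subst hWeq
  haveI : Fact (Nat.Prime 3) := ⟨Nat.prime_three⟩
  haveI : NumberField ↥((⟨0, 0, 0, (-6762), 214032⟩ : WeierstrassCurve ℚ).divisionField 3) := NumberField.mk
  exact CoatesSujatha2005.conjA_of_homTrivial_divisionField _ (by decide)
    (DivisionFieldFukudaDoor.not_dvd_card_aut_divisionField_three_of_Δ_eq_cube _ irr_g338688cg1_3 Δ_cube_g338688cg1) hκ h0 hD

/-- **RECORD — U₀ `ord₃ #Ш(E) ≤ ord₃ #Ш(E)_an` for `E = 338688cg1` at `p = 3` on the fact-free door L6, hom-trivial form** (U₀-ns row of K9 items 19189 / 19197):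
KERNEL `classO6_g338688cg1_3`, `irr_g338688cg1_3`, `Δ_cube_g338688cg1`; DISPLAYED named facts `hKatoA hGZK hmod` ONLY, Cremona's `r_an = 0` (`hr`), and the two
numerics `h0` (`m_ρ̄(Cl(ℚ(E[3]))/3) = 0`, `h = 324`, GRH) / `hD` (`#E(ℚ₃)[3] = 1`). Per row; nothing booked; BSD is not proved by this.
[cite: Kato2004Asterisque, Thm. 14.5 (3) (p. 236) and Prop. 14.16 (2)] [cite: CoatesSujatha2005, §3 Thm. 3.4]
[cite: DeoRaySujatha2023, §3 Thm. 3.8 (c2)] [cite: Cremona2006, Table 1 (Cremona label 338688cg1)] -/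
theorem missingUpperBoundAt_g338688cg1_3_L6h
    (hKatoA : Kato2004.rankZero_padicValNat_sha_add_padicValNat_tamagawa_le_of_additive_potGood_of_irreducible_of_fineSelmerDual_fg)
    (hGZK : rank_eq_analyticRank_of_analyticRank_le_one) (hmod : hasEntireLFunction_rat)
    {W : WeierstrassCurve ℚ} [W.IsElliptic] [W.IsGloballyMinimal] (hWeq : W = (⟨0, 0, 0, (-6762), 214032⟩ : WeierstrassCurve ℚ)) (hr : W.analyticRank = 0)
    (h0 : haveI : NumberField ↥(W.divisionField 3) := NumberField.mk
      ∀ μ : Additive (ClassGroup (𝓞 ↥(W.divisionField 3))) →+ geomTorsion W ((3 : ℕ) : ℤ),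
        (∀ (τ : absoluteGaloisGroup ℚ) (c : ClassGroup (𝓞 ↥(W.divisionField 3))),
          μ (Additive.ofMul (ClassGroup.mulEquiv
            (Literature.NumberTheory.NumberFields.AmbiguousClass.intAut (absRestrictNormalHom (W.divisionField 3) τ)) c)) =
            τ • μ (Additive.ofMul c)) → μ = 0)
    (hD : ∀ v : HeightOneSpectrum (𝓞 ℚ), ((3 : ℕ) : 𝓞 ℚ) ∈ v.asIdeal →
      ∀ x : geomTorsion W ((3 : ℕ) : ℤ), (∀ δ ∈ GreenbergSelmer.decomp v, δ • x = x) → x = 0) :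
    MissingUpperBoundAt W 3 := by
  subst hWeq
  haveI : Fact (Nat.Prime 3) := ⟨Nat.prime_three⟩
  exact WildFineSelmerSupersingularCMAnchor.missingUpperBoundAt_wild_of_conjA hKatoA hGZK hmod _ hr classO6_g338688cg1_3 irr_g338688cg1_3
    (fun κ hκ => conjA_g338688cg1_3_L6h rfl h0 hD κ hκ)

/-! ### `382347cq1` @ `p = 3` — `N = 382347`; Cremona: `r_an = 0`; O6 wild at `3`; image `3Nn` (census); `ℚ(E[3])` of degree `16`: `h = 72` (CERT; `3 ∣ h`, `E[3]` ABSENT from `Cl ⊗ 𝔽₃`);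
`m_ρ̄(Cl/3) = 0` (kit j313355/j313432); `#E(ℚ₃)[3] = 1` (kit j265757); bad places `7:1;17:1`. First fact-free (A) record for this row. -/

/-- `Δ(382347cq1) = ((-54621))³` — a CUBE (kernel, `norm_num`). [cite: Serre1972, §5.3] [cite: Cremona2006, Table 1 (Cremona label 382347cq1)] -/
theorem Δ_cube_g382347cq1 : (⟨1, (-1), 0, 3414, (-610219)⟩ : WeierstrassCurve ℚ).Δ = (((-54621) : ℚ)) ^ 3 := by
  norm_num [WeierstrassCurve.Δ, WeierstrassCurve.b₂, WeierstrassCurve.b₄, WeierstrassCurve.b₆, WeierstrassCurve.b₈]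

/-- **(A) AT `(382347cq1, 3)` — NO NAMED FACT (hom-trivial door L6).**  Statement (A) of Coates–Sujatha for THIS curve at `p = 3` (the dual fine Selmer group over
`ℚ_cyc` is finitely generated over `ℤ₃`, every cyclotomic `ℤ₃`-extension), by door L6 (hom-trivial form): KERNEL `irr_g382347cq1_3`, `Δ_cube_g382347cq1`;
DISPLAYED `h0` ((c2*)₀: no `E[3]` in `Cl(ℚ(E[3])) ⊗ 𝔽₃` — `h = 72`, `m_ρ̄ = 0`, CERT, kit j313355/j313432) and `hD` (`E(ℚ₃)[3] = 0`; `t3 = 1`, kit j265757).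
Per row; nothing booked. [cite: CoatesSujatha2005, §3 Thm. 3.4, Lemma 3.8 and Cor. 3.6] [cite: DeoRaySujatha2023, §3 Thm. 3.8 (c2) (arXiv:2202.09937 p. 9)]
[cite: Serre1972, §2.4 Prop. 15, §5.3] [cite: Cremona2006, Table 1 (Cremona label 382347cq1)] -/
theorem conjA_g382347cq1_3_L6h
    {W : WeierstrassCurve ℚ} [W.IsElliptic] (hWeq : W = (⟨1, (-1), 0, 3414, (-610219)⟩ : WeierstrassCurve ℚ))
    (h0 : haveI : NumberField ↥(W.divisionField 3) := NumberField.mk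
      ∀ μ : Additive (ClassGroup (𝓞 ↥(W.divisionField 3))) →+ geomTorsion W ((3 : ℕ) : ℤ),
        (∀ (τ : absoluteGaloisGroup ℚ) (c : ClassGroup (𝓞 ↥(W.divisionField 3))),
          μ (Additive.ofMul (ClassGroup.mulEquiv
            (Literature.NumberTheory.NumberFields.AmbiguousClass.intAut (absRestrictNormalHom (W.divisionField 3) τ)) c)) =
            τ • μ (Additive.ofMul c)) → μ = 0)
    (hD : ∀ v : HeightOneSpectrum (𝓞 ℚ), ((3 : ℕ) : 𝓞 ℚ) ∈ v.asIdeal →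
      ∀ x : geomTorsion W ((3 : ℕ) : ℤ), (∀ δ ∈ GreenbergSelmer.decomp v, δ • x = x) → x = 0)
    (κ : ZpExtension ℚ 3) (hκ : κ.IsCyclotomic) :
    ∃ (γ : absoluteGaloisGroup ℚ) (Df : W.FineSelmerDualData κ γ),
      Module.Finite ℤ_[3] (RestrictScalars ℤ_[3] (IwasawaAlgebra 3) Df.X) := by
  subst hWeq
  haveI : Fact (Nat.Prime 3) := ⟨Nat.prime_three⟩
  haveI : NumberField ↥((⟨1, (-1), 0, 3414, (-610219)⟩ : WeierstrassCurve ℚ).divisionField 3) := NumberField.mk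
  exact CoatesSujatha2005.conjA_of_homTrivial_divisionField _ (by decide)
    (DivisionFieldFukudaDoor.not_dvd_card_aut_divisionField_three_of_Δ_eq_cube _ irr_g382347cq1_3 Δ_cube_g382347cq1) hκ h0 hD

/-- **RECORD — U₀ `ord₃ #Ш(E) ≤ ord₃ #Ш(E)_an` for `E = 382347cq1` at `p = 3` on the fact-free door L6, hom-trivial form** (U₀-ns row of K9 items 19189 / 19197):
KERNEL `classO6_g382347cq1_3`, `irr_g382347cq1_3`, `Δ_cube_g382347cq1`; DISPLAYED named facts `hKatoA hGZK hmod` ONLY, Cremona's `r_an = 0` (`hr`), and the two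
numerics `h0` (`m_ρ̄(Cl(ℚ(E[3]))/3) = 0`, `h = 72`, CERT) / `hD` (`#E(ℚ₃)[3] = 1`). Per row; nothing booked; BSD is not proved by this.
[cite: Kato2004Asterisque, Thm. 14.5 (3) (p. 236) and Prop. 14.16 (2)] [cite: CoatesSujatha2005, §3 Thm. 3.4]
[cite: DeoRaySujatha2023, §3 Thm. 3.8 (c2)] [cite: Cremona2006, Table 1 (Cremona label 382347cq1)] -/
theorem missingUpperBoundAt_g382347cq1_3_L6h
    (hKatoA : Kato2004.rankZero_padicValNat_sha_add_padicValNat_tamagawa_le_of_additive_potGood_of_irreducible_of_fineSelmerDual_fg)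
    (hGZK : rank_eq_analyticRank_of_analyticRank_le_one) (hmod : hasEntireLFunction_rat)
    {W : WeierstrassCurve ℚ} [W.IsElliptic] [W.IsGloballyMinimal] (hWeq : W = (⟨1, (-1), 0, 3414, (-610219)⟩ : WeierstrassCurve ℚ)) (hr : W.analyticRank = 0)
    (h0 : haveI : NumberField ↥(W.divisionField 3) := NumberField.mk
      ∀ μ : Additive (ClassGroup (𝓞 ↥(W.divisionField 3))) →+ geomTorsion W ((3 : ℕ) : ℤ),
        (∀ (τ : absoluteGaloisGroup ℚ) (c : ClassGroup (𝓞 ↥(W.divisionField 3))),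
          μ (Additive.ofMul (ClassGroup.mulEquiv
            (Literature.NumberTheory.NumberFields.AmbiguousClass.intAut (absRestrictNormalHom (W.divisionField 3) τ)) c)) =
            τ • μ (Additive.ofMul c)) → μ = 0)
    (hD : ∀ v : HeightOneSpectrum (𝓞 ℚ), ((3 : ℕ) : 𝓞 ℚ) ∈ v.asIdeal →
      ∀ x : geomTorsion W ((3 : ℕ) : ℤ), (∀ δ ∈ GreenbergSelmer.decomp v, δ • x = x) → x = 0) :
    MissingUpperBoundAt W 3 := by
  subst hWeq
  haveI : Fact (Nat.Prime 3) := ⟨Nat.prime_three⟩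
  exact WildFineSelmerSupersingularCMAnchor.missingUpperBoundAt_wild_of_conjA hKatoA hGZK hmod _ hr classO6_g382347cq1_3 irr_g382347cq1_3
    (fun κ hκ => conjA_g382347cq1_3_L6h rfl h0 hD κ hκ)

/-! ### `382347cv1` @ `p = 3` — `N = 382347`; Cremona: `r_an = 0`; O6 wild at `3`; image `3Nn` (census); `ℚ(E[3])` of degree `16`: `h = 72` (CERT; `3 ∣ h`, `E[3]` ABSENT from `Cl ⊗ 𝔽₃`);
`m_ρ̄(Cl/3) = 0` (kit j313355/j313432); `#E(ℚ₃)[3] = 1` (kit j265757); bad places `7:1;17:1`. First fact-free (A) record for this row. -/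

/-- `Δ(382347cv1) = ((-928557))³` — a CUBE (kernel, `norm_num`). [cite: Serre1972, §5.3] [cite: Cremona2006, Table 1 (Cremona label 382347cv1)] -/
theorem Δ_cube_g382347cv1 : (⟨1, (-1), 0, (-9609882), (-11464028731)⟩ : WeierstrassCurve ℚ).Δ = (((-928557) : ℚ)) ^ 3 := by
  norm_num [WeierstrassCurve.Δ, WeierstrassCurve.b₂, WeierstrassCurve.b₄, WeierstrassCurve.b₆, WeierstrassCurve.b₈]

/-- **(A) AT `(382347cv1, 3)` — NO NAMED FACT (hom-trivial door L6).**  Statement (A) of Coates–Sujatha for THIS curve at `p = 3` (the dual fine Selmer group over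
`ℚ_cyc` is finitely generated over `ℤ₃`, every cyclotomic `ℤ₃`-extension), by door L6 (hom-trivial form): KERNEL `irr_g382347cv1_3`, `Δ_cube_g382347cv1`;
DISPLAYED `h0` ((c2*)₀: no `E[3]` in `Cl(ℚ(E[3])) ⊗ 𝔽₃` — `h = 72`, `m_ρ̄ = 0`, CERT, kit j313355/j313432) and `hD` (`E(ℚ₃)[3] = 0`; `t3 = 1`, kit j265757).
Per row; nothing booked. [cite: CoatesSujatha2005, §3 Thm. 3.4, Lemma 3.8 and Cor. 3.6] [cite: DeoRaySujatha2023, §3 Thm. 3.8 (c2) (arXiv:2202.09937 p. 9)]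
[cite: Serre1972, §2.4 Prop. 15, §5.3] [cite: Cremona2006, Table 1 (Cremona label 382347cv1)] -/
theorem conjA_g382347cv1_3_L6h
    {W : WeierstrassCurve ℚ} [W.IsElliptic] (hWeq : W = (⟨1, (-1), 0, (-9609882), (-11464028731)⟩ : WeierstrassCurve ℚ))
    (h0 : haveI : NumberField ↥(W.divisionField 3) := NumberField.mk
      ∀ μ : Additive (ClassGroup (𝓞 ↥(W.divisionField 3))) →+ geomTorsion W ((3 : ℕ) : ℤ),
        (∀ (τ : absoluteGaloisGroup ℚ) (c : ClassGroup (𝓞 ↥(W.divisionField 3))),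
          μ (Additive.ofMul (ClassGroup.mulEquiv
            (Literature.NumberTheory.NumberFields.AmbiguousClass.intAut (absRestrictNormalHom (W.divisionField 3) τ)) c)) =
            τ • μ (Additive.ofMul c)) → μ = 0)
    (hD : ∀ v : HeightOneSpectrum (𝓞 ℚ), ((3 : ℕ) : 𝓞 ℚ) ∈ v.asIdeal →
      ∀ x : geomTorsion W ((3 : ℕ) : ℤ), (∀ δ ∈ GreenbergSelmer.decomp v, δ • x = x) → x = 0)
    (κ : ZpExtension ℚ 3) (hκ : κ.IsCyclotomic) :
    ∃ (γ : absoluteGaloisGroup ℚ) (Df : W.FineSelmerDualData κ γ),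
      Module.Finite ℤ_[3] (RestrictScalars ℤ_[3] (IwasawaAlgebra 3) Df.X) := by
  subst hWeq
  haveI : Fact (Nat.Prime 3) := ⟨Nat.prime_three⟩
  haveI : NumberField ↥((⟨1, (-1), 0, (-9609882), (-11464028731)⟩ : WeierstrassCurve ℚ).divisionField 3) := NumberField.mk
  exact CoatesSujatha2005.conjA_of_homTrivial_divisionField _ (by decide)
    (DivisionFieldFukudaDoor.not_dvd_card_aut_divisionField_three_of_Δ_eq_cube _ irr_g382347cv1_3 Δ_cube_g382347cv1) hκ h0 hD

/-- **RECORD — U₀ `ord₃ #Ш(E) ≤ ord₃ #Ш(E)_an` for `E = 382347cv1` at `p = 3` on the fact-free door L6, hom-trivial form** (U₀-ns row of K9 items 19189 / 19197):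
KERNEL `classO6_g382347cv1_3`, `irr_g382347cv1_3`, `Δ_cube_g382347cv1`; DISPLAYED named facts `hKatoA hGZK hmod` ONLY, Cremona's `r_an = 0` (`hr`), and the two
numerics `h0` (`m_ρ̄(Cl(ℚ(E[3]))/3) = 0`, `h = 72`, CERT) / `hD` (`#E(ℚ₃)[3] = 1`). Per row; nothing booked; BSD is not proved by this.
[cite: Kato2004Asterisque, Thm. 14.5 (3) (p. 236) and Prop. 14.16 (2)] [cite: CoatesSujatha2005, §3 Thm. 3.4]
[cite: DeoRaySujatha2023, §3 Thm. 3.8 (c2)] [cite: Cremona2006, Table 1 (Cremona label 382347cv1)] -/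
theorem missingUpperBoundAt_g382347cv1_3_L6h
    (hKatoA : Kato2004.rankZero_padicValNat_sha_add_padicValNat_tamagawa_le_of_additive_potGood_of_irreducible_of_fineSelmerDual_fg)
    (hGZK : rank_eq_analyticRank_of_analyticRank_le_one) (hmod : hasEntireLFunction_rat)
    {W : WeierstrassCurve ℚ} [W.IsElliptic] [W.IsGloballyMinimal] (hWeq : W = (⟨1, (-1), 0, (-9609882), (-11464028731)⟩ : WeierstrassCurve ℚ)) (hr : W.analyticRank = 0)
    (h0 : haveI : NumberField ↥(W.divisionField 3) := NumberField.mk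
      ∀ μ : Additive (ClassGroup (𝓞 ↥(W.divisionField 3))) →+ geomTorsion W ((3 : ℕ) : ℤ),
        (∀ (τ : absoluteGaloisGroup ℚ) (c : ClassGroup (𝓞 ↥(W.divisionField 3))),
          μ (Additive.ofMul (ClassGroup.mulEquiv
            (Literature.NumberTheory.NumberFields.AmbiguousClass.intAut (absRestrictNormalHom (W.divisionField 3) τ)) c)) =
            τ • μ (Additive.ofMul c)) → μ = 0)
    (hD : ∀ v : HeightOneSpectrum (𝓞 ℚ), ((3 : ℕ) : 𝓞 ℚ) ∈ v.asIdeal →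
      ∀ x : geomTorsion W ((3 : ℕ) : ℤ), (∀ δ ∈ GreenbergSelmer.decomp v, δ • x = x) → x = 0) :
    MissingUpperBoundAt W 3 := by
  subst hWeq
  haveI : Fact (Nat.Prime 3) := ⟨Nat.prime_three⟩
  exact WildFineSelmerSupersingularCMAnchor.missingUpperBoundAt_wild_of_conjA hKatoA hGZK hmod _ hr classO6_g382347cv1_3 irr_g382347cv1_3
    (fun κ hκ => conjA_g382347cv1_3_L6h rfl h0 hD κ hκ)

/-! ### `382347g1` @ `p = 3` — `N = 382347`; Cremona: `r_an = 0`; O6 wild at `3`; image `3Nn` (census); `ℚ(E[3])` of degree `16`: `h = 72` (CERT; `3 ∣ h`, `E[3]` ABSENT from `Cl ⊗ 𝔽₃`);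
`m_ρ̄(Cl/3) = 0` (kit j313355/j313432); `#E(ℚ₃)[3] = 1` (kit j265757); bad places `7:1;17:1`. First fact-free (A) record for this row. -/

/-- `Δ(382347g1) = (45499293)³` — a CUBE (kernel, `norm_num`). [cite: Serre1972, §5.3] [cite: Cremona2006, Table 1 (Cremona label 382347g1)] -/
theorem Δ_cube_g382347g1 : (⟨0, 0, 1, (-13382145), 11704693124⟩ : WeierstrassCurve ℚ).Δ = ((45499293 : ℚ)) ^ 3 := by
  norm_num [WeierstrassCurve.Δ, WeierstrassCurve.b₂, WeierstrassCurve.b₄, WeierstrassCurve.b₆, WeierstrassCurve.b₈]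

/-- **(A) AT `(382347g1, 3)` — NO NAMED FACT (hom-trivial door L6).**  Statement (A) of Coates–Sujatha for THIS curve at `p = 3` (the dual fine Selmer group over
`ℚ_cyc` is finitely generated over `ℤ₃`, every cyclotomic `ℤ₃`-extension), by door L6 (hom-trivial form): KERNEL `irr_g382347g1_3`, `Δ_cube_g382347g1`;
DISPLAYED `h0` ((c2*)₀: no `E[3]` in `Cl(ℚ(E[3])) ⊗ 𝔽₃` — `h = 72`, `m_ρ̄ = 0`, CERT, kit j313355/j313432) and `hD` (`E(ℚ₃)[3] = 0`; `t3 = 1`, kit j265757).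
Per row; nothing booked. [cite: CoatesSujatha2005, §3 Thm. 3.4, Lemma 3.8 and Cor. 3.6] [cite: DeoRaySujatha2023, §3 Thm. 3.8 (c2) (arXiv:2202.09937 p. 9)]
[cite: Serre1972, §2.4 Prop. 15, §5.3] [cite: Cremona2006, Table 1 (Cremona label 382347g1)] -/
theorem conjA_g382347g1_3_L6h
    {W : WeierstrassCurve ℚ} [W.IsElliptic] (hWeq : W = (⟨0, 0, 1, (-13382145), 11704693124⟩ : WeierstrassCurve ℚ))
    (h0 : haveI : NumberField ↥(W.divisionField 3) := NumberField.mk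
      ∀ μ : Additive (ClassGroup (𝓞 ↥(W.divisionField 3))) →+ geomTorsion W ((3 : ℕ) : ℤ),
        (∀ (τ : absoluteGaloisGroup ℚ) (c : ClassGroup (𝓞 ↥(W.divisionField 3))),
          μ (Additive.ofMul (ClassGroup.mulEquiv
            (Literature.NumberTheory.NumberFields.AmbiguousClass.intAut (absRestrictNormalHom (W.divisionField 3) τ)) c)) =
            τ • μ (Additive.ofMul c)) → μ = 0)
    (hD : ∀ v : HeightOneSpectrum (𝓞 ℚ), ((3 : ℕ) : 𝓞 ℚ) ∈ v.asIdeal →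
      ∀ x : geomTorsion W ((3 : ℕ) : ℤ), (∀ δ ∈ GreenbergSelmer.decomp v, δ • x = x) → x = 0)
    (κ : ZpExtension ℚ 3) (hκ : κ.IsCyclotomic) :
    ∃ (γ : absoluteGaloisGroup ℚ) (Df : W.FineSelmerDualData κ γ),
      Module.Finite ℤ_[3] (RestrictScalars ℤ_[3] (IwasawaAlgebra 3) Df.X) := by
  subst hWeq
  haveI : Fact (Nat.Prime 3) := ⟨Nat.prime_three⟩
  haveI : NumberField ↥((⟨0, 0, 1, (-13382145), 11704693124⟩ : WeierstrassCurve ℚ).divisionField 3) := NumberField.mk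
  exact CoatesSujatha2005.conjA_of_homTrivial_divisionField _ (by decide)
    (DivisionFieldFukudaDoor.not_dvd_card_aut_divisionField_three_of_Δ_eq_cube _ irr_g382347g1_3 Δ_cube_g382347g1) hκ h0 hD

/-- **RECORD — U₀ `ord₃ #Ш(E) ≤ ord₃ #Ш(E)_an` for `E = 382347g1` at `p = 3` on the fact-free door L6, hom-trivial form** (U₀-ns row of K9 items 19189 / 19197):
KERNEL `classO6_g382347g1_3`, `irr_g382347g1_3`, `Δ_cube_g382347g1`; DISPLAYED named facts `hKatoA hGZK hmod` ONLY, Cremona's `r_an = 0` (`hr`), and the two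
numerics `h0` (`m_ρ̄(Cl(ℚ(E[3]))/3) = 0`, `h = 72`, CERT) / `hD` (`#E(ℚ₃)[3] = 1`). Per row; nothing booked; BSD is not proved by this.
[cite: Kato2004Asterisque, Thm. 14.5 (3) (p. 236) and Prop. 14.16 (2)] [cite: CoatesSujatha2005, §3 Thm. 3.4]
[cite: DeoRaySujatha2023, §3 Thm. 3.8 (c2)] [cite: Cremona2006, Table 1 (Cremona label 382347g1)] -/
theorem missingUpperBoundAt_g382347g1_3_L6h
    (hKatoA : Kato2004.rankZero_padicValNat_sha_add_padicValNat_tamagawa_le_of_additive_potGood_of_irreducible_of_fineSelmerDual_fg)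
    (hGZK : rank_eq_analyticRank_of_analyticRank_le_one) (hmod : hasEntireLFunction_rat)
    {W : WeierstrassCurve ℚ} [W.IsElliptic] [W.IsGloballyMinimal] (hWeq : W = (⟨0, 0, 1, (-13382145), 11704693124⟩ : WeierstrassCurve ℚ)) (hr : W.analyticRank = 0)
    (h0 : haveI : NumberField ↥(W.divisionField 3) := NumberField.mk
      ∀ μ : Additive (ClassGroup (𝓞 ↥(W.divisionField 3))) →+ geomTorsion W ((3 : ℕ) : ℤ),
        (∀ (τ : absoluteGaloisGroup ℚ) (c : ClassGroup (𝓞 ↥(W.divisionField 3))),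
          μ (Additive.ofMul (ClassGroup.mulEquiv
            (Literature.NumberTheory.NumberFields.AmbiguousClass.intAut (absRestrictNormalHom (W.divisionField 3) τ)) c)) =
            τ • μ (Additive.ofMul c)) → μ = 0)
    (hD : ∀ v : HeightOneSpectrum (𝓞 ℚ), ((3 : ℕ) : 𝓞 ℚ) ∈ v.asIdeal →
      ∀ x : geomTorsion W ((3 : ℕ) : ℤ), (∀ δ ∈ GreenbergSelmer.decomp v, δ • x = x) → x = 0) :
    MissingUpperBoundAt W 3 := by
  subst hWeq
  haveI : Fact (Nat.Prime 3) := ⟨Nat.prime_three⟩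
  exact WildFineSelmerSupersingularCMAnchor.missingUpperBoundAt_wild_of_conjA hKatoA hGZK hmod _ hr classO6_g382347g1_3 irr_g382347g1_3
    (fun κ hκ => conjA_g382347g1_3_L6h rfl h0 hD κ hκ)

end Summit.BirchSwinnertonDyer.BirchSwinnertonDyer.Theorems.WildFineSelmerClassNumberL6Records

end
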